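import Literature.IUT.HodgeTheaters.PuncturedEllipticCoveringsCor12OfGeomOriginEx48CuspGalois
import Literature.IUT.HodgeTheaters.PuncturedEllipticProLModelLabels
import Literature.IUT.HodgeTheaters.InitialThetaDataCor12Derived
import HarnessLib

/-!
# [IUTchI] Cor. 1.2 at the genuine `K`-level data — the grand knit over [AbsTopI] Example 4.8 with the printed
# `Δ_ε`-sentences (L2a) (L2c) DERIVED, no replacement binder (proof-only sequel)

Mochizuki, *Inter-universal Teichmüller theory I*, kurims manuscript (May 2020), §1 p. 37 l. 30–36 («`0 → I_ε′ × I_ε″ → Δ_ε`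
… `I_ε′ ≅ ℤ/lℤ`») and Corollary 1.2 p. 39 ([IUTchI] Cor 1.2 p.39) [claim: Mochizuki2012, status: disputed] (D-0012 claim
key; series status DISPUTED — nothing of the series is asserted here); classical input [AbsTopI] Lemma 4.5 (i) p. 54
[cite: MochizukiAbsTopI2012, Lemma 4.5 (i) p.54].

Cell abc-iut, seat abc-iut-L5-d4 (gen 12), row R45 «COR12-MODL-LAWS-DERIVE@M_l» (abc-iut-L5-lead RULINGS #118 (2)(a)).
PROOF-ONLY knit (no `def`, no instance, no new `Prop` fact): abc-iut-L5-t1's closer «cor12_v14»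
`InitialThetaData.pe_characteristicNatureOfCoverings_of_geomOrigin_ex48_cuspGalois` ((L4) discharged from (∗) + cusp
rationality; built on abc-iut-w6-d032's p496734) with its four LAW binders `hL2a hL2c hL2a′ hL2c′` — the printed sentences
(L2a) «`I_ε′ ≅ ℤ/lℤ` in `Δ_ε`» and (L2c) «`0 → I_ε′ × I_ε″ → Δ_ε`» at the two data — DISCHARGED, with NO replacement binder, by
abc-iut-L5-d4's `GeomOrigin.inertia_ε1_image_order_of_cuspGalois` / `GeomOrigin.inertia_images_inf_le_of_cuspGalois`
(`PuncturedEllipticProLModelLabels`: the `Δ_X̲`-abelian pro-`l` shadow of the origin record; the cusp labels are injective because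
`Π_X̲`-conjugation fixes cusp inertia modulo `Ker(Δ_X̲ ↠ Δ_X̲^{ab} ⊗ ℤ/l)` — (L4), abc-iut-w4-d051/abc-iut-L5-t1's
`GeomOrigin.inertia_central`).  The inputs `l` prime and `[Π_X : Π_X̲] = l` are the initial Θ-datum's own fields (`l_prime`,
`ThetaGeometry.PiXbar_relIndex`, `pe_l`).  Displayed binders of the result: DATA `C C′ A` + the Example 4.8 / Cor. 3.3 member
data; ORIGIN `O O′`; LAW `hL3 hL3′` (printed (L3) — cf. abc-iut-L5-t1's (REL′)-route p502003/p506512 with abc-iut-w6-d032's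
p506921); GAP `h0 h0′` (G-L5d4g6-1); FACT `hA hA′` (F-0206) and F-0193 / F-0294 by name.  Binder count of the printed
`Δ_ε`-sentences: 6 → 2.

HONEST FRAMING: nothing here asserts that abc is proved or refuted or takes a side on [IUTchIII] Cor. 3.12; every remaining
binder is an assumption label quoting print or a named FACT row, asserted for no instance; typed ≠ inhabited ≠ discharged.
-/

noncomputable section

open CategoryTheory Topology

namespace Literature.IUT.HodgeTheaters.InitialThetaData

open scoped Pointwise
open Literature.AlgebraicGeometry.Frobenioids (IsSlimGroup)
open Literature.AnabelianGeometry.AbsoluteAnabelian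
open Literature.AnabelianGeometry.AbsoluteAnabelian.FundamentalExtension (CuspidalAlgorithm)
open Literature.AnabelianGeometry.AbsoluteAnabelian.AbsTopI (ConstructionDataClass)
open Literature.AnabelianGeometry.AbsoluteAnabelian.AbsTopII (EllipticModel)

universe u u'

variable {F : Type u} {K : Type} {Fbar : Type} [Field F] [NumberField F] [Field K] [NumberField K]
  [Algebra F K] [Field Fbar] [Algebra F Fbar] [Algebra K Fbar]
  {E : WeierstrassCurve F} [E.IsElliptic] {l : ℕ} {Pb : BadPlacePredicates K}
  (D : InitialThetaData F K Fbar E l Pb)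
  {F' : Type u'} {K' : Type} [Field F'] [NumberField F'] [Field K'] [NumberField K'] [Algebra F' K']
  {Fbar' : Type} [Field Fbar'] [Algebra F' Fbar'] [Algebra K' Fbar']
  {E' : WeierstrassCurve F'} [E'.IsElliptic] {l' : ℕ} {Pb' : BadPlacePredicates K'}
  (D' : InitialThetaData F' K' Fbar' E' l' Pb')

/-- The `K`-level §1 datum's `l` is prime (`pe_l`, `l_prime`). ([IUTchI] Def 3.1 (c) p.62) [claim: Mochizuki2012, status: disputed] -/
theorem pe_l_prime' : D.geom.pe.l.Prime := by
  rw [D.geom.pe_l]; exact D.l_prime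

/-- **[IUTchI] Cor. 1.2 between the `K`-level data of two initial Θ-data over a class of [AbsTopI] Example 4.8 (i), with
(L2a) (L2c) DERIVED and no replacement binder** («cor12_v14» of abc-iut-L5-t1 with `hL2a hL2c hL2a′ hL2c′` discharged by
abc-iut-L5-d4's `GeomOrigin.inertia_ε1_image_order_of_cuspGalois` / `GeomOrigin.inertia_images_inf_le_of_cuspGalois` — the
pro-`l` shadow derivation, row R45; `l` prime and `[Π_X : Π_X̲] = l` are the initial Θ-datum's fields).
([IUTchI] Cor 1.2 p.39) [claim: Mochizuki2012, status: disputed] -/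
theorem pe_characteristicNatureOfCoverings_of_geomOrigin_ex48_cuspGalois_derivedL2
    (O : D.geom.pe.GeomOrigin) (O' : D'.geom.pe.GeomOrigin)
    (C : D.geom.pe.CuspGalois) (C' : D'.geom.pe.CuspGalois)
    -- a class of [AbsTopI] Example 4.8 (i) with its named fact F-0193, a Cor 3.3/3.4 model over it, F-0294 by name
    {𝒟 : ConstructionDataClass.{0}} {p : ℕ} [Fact p.Prime] (h𝒟 : 𝒟.IsEx48ClassGen p) (hEx : 𝒟.Ex_4_8_i p)
    (M : EllipticModel 𝒟) (h33 : M.Cor_3_3_i)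
    -- members X, X′ over number fields, realised by Π_{X̲→}, Π′_{X̲→} with k-cores Π_C, Π′_C
    {bX bX' : 𝒟.Base} [NumberField (𝒟.fld bX)] [NumberField (𝒟.fld bX')]
    {X : (𝒟.datum bX).Obj} {X' : (𝒟.datum bX').Obj}
    (hmemX : 𝒟.Mem bX X) (hadmX : M.IsEllipticallyAdmissible bX X) (hΔX : IsSlimGroup ((𝒟.datum bX).ext X).geom)
    (hneX : ((𝒟.datum bX).ext X).geom ≠ ⊥) (htfgX : ((𝒟.datum bX).ext X).GeomTFG)
    (hmemX' : 𝒟.Mem bX' X') (hadmX' : M.IsEllipticallyAdmissible bX' X') (hΔX' : IsSlimGroup ((𝒟.datum bX').ext X').geom)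
    (hneX' : ((𝒟.datum bX').ext X').geom ≠ ⊥) (htfgX' : ((𝒟.datum bX').ext X').GeomTFG)
    (hS : (𝒟.datum bX').primes = (𝒟.datum bX).primes)
    (ePi : ((𝒟.datum bX).ext X).arith ≃ₜ* D.geom.pe.piXarrow) (eC : (M.coreExt bX X).arith ≃ₜ* D.geom.pe.PiC)
    (hcomp : ∀ x, eC ((M.toCore bX X).arith x) = (ePi x : D.geom.pe.PiC))
    (ePi' : ((𝒟.datum bX').ext X').arith ≃ₜ* D'.geom.pe.piXarrow) (eC' : (M.coreExt bX' X').arith ≃ₜ* D'.geom.pe.PiC)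
    (hcomp' : ∀ x, eC' ((M.toCore bX' X').arith x) = (ePi' x : D'.geom.pe.PiC))
    -- members Y, Y′ over number fields, realised by Π_{C̲→}, Π′_{C̲→} with k-cores Π_C, Π′_C
    {bY bY' : 𝒟.Base} [NumberField (𝒟.fld bY)] [NumberField (𝒟.fld bY')]
    {Y : (𝒟.datum bY).Obj} {Y' : (𝒟.datum bY').Obj}
    (hmemY : 𝒟.Mem bY Y) (hadmY : M.IsEllipticallyAdmissible bY Y) (hΔY : IsSlimGroup ((𝒟.datum bY).ext Y).geom)
    (hneY : ((𝒟.datum bY).ext Y).geom ≠ ⊥) (htfgY : ((𝒟.datum bY).ext Y).GeomTFG)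
    (hmemY' : 𝒟.Mem bY' Y') (hadmY' : M.IsEllipticallyAdmissible bY' Y') (hΔY' : IsSlimGroup ((𝒟.datum bY').ext Y').geom)
    (hneY' : ((𝒟.datum bY').ext Y').geom ≠ ⊥) (htfgY' : ((𝒟.datum bY').ext Y').GeomTFG)
    (hSY : (𝒟.datum bY').primes = (𝒟.datum bY).primes)
    (fPi : ((𝒟.datum bY).ext Y).arith ≃ₜ* D.geom.pe.piCarrow) (fC : (M.coreExt bY Y).arith ≃ₜ* D.geom.pe.PiC)
    (hcompY : ∀ x, fC ((M.toCore bY Y).arith x) = (fPi x : D.geom.pe.PiC))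
    (fPi' : ((𝒟.datum bY').ext Y').arith ≃ₜ* D'.geom.pe.piCarrow) (fC' : (M.coreExt bY' Y').arith ≃ₜ* D'.geom.pe.PiC)
    (hcompY' : ∀ x, fC' ((M.toCore bY' Y').arith x) = (fPi' x : D'.geom.pe.PiC))
    -- the six printed Δ_ε-level LABEL sentences (L2a)(L2c)(L3) at the two data
    (hL3 : ∀ c ∈ D.geom.pe.DeltaCbar, c ∉ D.geom.pe.DeltaXbar → ∀ v ∈ D.geom.pe.DeltaXbar,
      c * v * c⁻¹ * v ∈ D.geom.pe.inertia D.geom.pe.ε1 ⊔ D.geom.pe.inertia D.geom.pe.ε2 ⊔ D.geom.pe.deltaEpsKer)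
    (hL3' : ∀ c ∈ D'.geom.pe.DeltaCbar, c ∉ D'.geom.pe.DeltaXbar → ∀ v ∈ D'.geom.pe.DeltaXbar,
      c * v * c⁻¹ * v ∈
        D'.geom.pe.inertia D'.geom.pe.ε1 ⊔ D'.geom.pe.inertia D'.geom.pe.ε2 ⊔ D'.geom.pe.deltaEpsKer)
    -- ramification of ε⁰ (GAP G-L5d4g6-1) and [AbsTopI] Lem 4.5 (v) (F-0206)
    (h0 : ¬ D.geom.pe.inertia D.geom.pe.ε0 ≤ D.geom.pe.piXarrow)
    (h0' : ¬ D'.geom.pe.inertia D'.geom.pe.ε0 ≤ D'.geom.pe.piXarrow)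
    (A : CuspidalAlgorithm.{0}) (hA : A.RecoversCusps D.geom.pe.extXbar C.cuspidalDataXbar)
    (hA' : A.RecoversCusps D'.geom.pe.extXbar C'.cuspidalDataXbar) :
    D.geom.pe.CharacteristicNatureOfCoverings D'.geom.pe :=
  D.pe_characteristicNatureOfCoverings_of_geomOrigin_ex48_cuspGalois D' O O' C C' h𝒟 hEx M h33 hmemX hadmX hΔX hneX htfgX
    hmemX' hadmX' hΔX' hneX' htfgX' hS ePi eC hcomp ePi' eC' hcomp' hmemY hadmY hΔY hneY htfgY hmemY' hadmY' hΔY' hneY' htfgY'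
    hSY fPi fC hcompY fPi' fC' hcompY'
    (O.inertia_ε1_image_order_of_cuspGalois C D.pe_l_prime' D.pe_relIndex_piXbar_piX)
    (O.inertia_images_inf_le_of_cuspGalois C D.pe_l_prime' D.pe_relIndex_piXbar_piX) hL3
    (O'.inertia_ε1_image_order_of_cuspGalois C' D'.pe_l_prime' D'.pe_relIndex_piXbar_piX)
    (O'.inertia_images_inf_le_of_cuspGalois C' D'.pe_l_prime' D'.pe_relIndex_piXbar_piX) hL3' h0 h0' A hA hA'

end Literature.IUT.HodgeTheaters.InitialThetaData
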